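import Literature.NumberTheory.EllipticCurves.KellerYin2024.PotentiallyGoodOrdinaryIwasawaTheory
import Literature.NumberTheory.EllipticCurves.TwistedHeegnerModule
import HarnessLib

/-!
# Keller–Yin (arXiv:2410.23241) §3.3–§3.5 in HEEGNER-POINT form: Thm. 3.3.6 (one divisibility of the
# Heegner point main conjecture for the Heegner pair of an elliptic curve), the last clause of
# Thm. 3.5.1 (the equality "equivalently, `Char_Λ(𝒳_tors) = Char_Λ(H¹_{𝓕_Λ}(K,𝐓)/Λκ_∞)²`"), and
# Prop. 3.4.4 ((HPMC) ⟹ (GrMC)) — PREPRINT CLAIMS (`_OPEN`), plus the proved bookkeeping between the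
# two currencies of this directory

T. Keller, M. Yin, *`p`-converse theorems for elliptic curves of potentially good ordinary reduction
at Eisenstein primes*, arXiv:2410.23241 **v1** (2024-10-30; store `paper:arxiv-2410.23241`, 22 chunks;
locators `[corpus:paper-arxiv-2410.23241 pNNNN:Lnn]` = chunk:line), UNREFEREED PREPRINT. Cell
`bsd-littype` (D-0088(4)), seat `bsd-littype-06` (gen 3). Sequel of
`PotentiallyGoodOrdinaryIwasawaTheory.lean` (same seat, gen 0), which typed the GREENBERG form of the
same theorems (`thm336_oneSided_isTorsion_mem_charIdeal_OPEN`, `thm351_imc_isTorsion_mu_zero_charIdeal_eq_OPEN`: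
`𝔛 = XAc`, Castella-shape BDP frames `IsBDPLFunction`) and recorded "the HPMC form needs `Λ`-adic
Heegner classes, not in the tree". That vocabulary now exists (`TwistedHeegnerModule.lean`:
`TwistedHeegnerFamily N′ W W′ K κ jbar`, `twistedHeegnerModule D F`, `twistedHeegnerCharIdeal D F`),
and this file types the Heegner-point side in EXACTLY the currency of the published siblings
`CastellaGrossiSkinner2025.thmC_charIdeal_torsion_eq_heegnerCharIdeal_sq` (Math. Ann. 393, Theorem C)
and `KellerYin2024.thmB_imc1_charIdeal_torsion_eq_heegnerCharIdeal_sq_OPEN` (typer 05):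
`LambdaAdicSelmerData` (`𝔖`), `SelmerDualData` (`𝒳`), characteristic ideal of `𝔖/ℋ`. Every fact is
`[claim: KellerYin2024PotOrd, status: under-review]`, suffix `_OPEN`, no `_holds`; NEVER cite them
as theorems.

## Citation header (verbatim) and transcription

* **Setting** (§3.1 p0013 L28–p0015 L10; §3.3 p0017 L1–L8; Assumption 2.0.3 p0008 L5–L11): `E/ℚ` with
  newform `f = f̃ ⊗ ε`, `f̃ ∈ S₂(Γ₀(N′), ε⁻²)` `p`-ordinary, "Case (I) … `p ∤ N′`", `E[p]` reducible
  with the lattice normalised so that `φ|_{G_p} ≠ 𝟙`, `H⁰(K, ρ̄_{f̃} ⊗ ε) = 0`, `K` a Heegner field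
  for `N` with `D_K` odd `≠ −3` and `p = v v̄` split → the gen-0 bundle `PotOrdSetting ι′ W K v v̄ κ N`
  (all of it, verbatim) PLUS, in `HPMCHypotheses`: `N = N′p²` and `p ∤ N′` (the level of `f̃`),
  `W′ ≅_ℚ E^{(p*)}` (the auxiliary curve whose newform is `f̃` — READ AT `e = 2`, the scope of the
  printed proof, where `ε = (·/p)`, `f̃ = f_{E^{(p*)}}`; OPEN-QUESTIONS-06 Q-B1/§C-1; a SPECIAL CASE
  of "a pair `(f̃, ε)` with `f = f̃ ⊗ ε`" if other pairs are meant), `γ` a topological generator, and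
  the tree-vocabulary EXTRA `p ∤ h_K` (Howard 2004 §3.3: the norm points `z_j` are genuine norms
  `Norm_{K[p^{j+1}]/K_j}` and `ℋ = Λκ₁`; flag KYb-hK, exactly as `ThmCHypotheses.not_dvd_classNumber`).
* **Dictionary for the modules** (the sibling's, `CastellaGrossiSkinner2025/HeegnerPointMainConjecture.lean`
  module docstring items 1–7, with ONE more step): `H¹_{𝓕_{Λ,ε}}(K, 𝐓_ε)` with `T_ε = T_pE` (§3.6
  p0020 L44) and the twisted-ordinary condition = Bloch–Kato = classical condition (Prop. 3.2.3,
  p0016 L50–L53: "The ordinary Selmer group of `f` … defined as the ordinary Selmer group twisted by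
  `ε` … agrees with the Bloch–Kato Selmer group for `V(f)`. Consequently, the two types of Selmer
  groups for `T_{f,α}` … and `A_{f,α}` … also agree") → `D : LambdaAdicSelmerData (W.baseChange K) κ γ`
  (`𝔖 = lim← S_p(E/K_n)`); `𝒳 = H¹_{𝓕_{Λ,ε}}(K, M_ε)^∨` (p0016 L78–L81), `M_ε = T_pE ⊗ Λ^∨`, by the
  same proposition and Shapiro `∼ Sel_{p^∞}(E/K_∞)^∨` (as the paper itself uses in §2.5, p0012 L63:
  "there is a pseudo-isomorphism from `Sel_{p^∞}(E/K_∞)^∨` to `X`") → `X : SelmerDualData (W.baseChange K) κ γ`;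
  `Λκ₁` ("a class coming from a Heegner point associated to the Heegner pair `(f̃, χ_ε)` as in
  [JLZ21]", Conj. 3.3.1 (ii), p0016 L88; = `Λ z_{(f̃,χ),∞}` up to a unit, p0019 L55; written `Λκ_∞` in Thm. 3.5.1,
  p0020 L33) → `twistedHeegnerModule D F` for a `TwistedHeegnerFamily F` of `(W, W′)` at level `N′`
  (flag KYb-kappa: the twisted analogue of Howard's Thm. 3.3.7 `ℋ = Λκ₁` is asserted by the source
  only as "(H.3) follows from an analog of [How2004]", p0017 L19); `Char_Λ` → `Module.charIdeal`
  over `Λ = IwasawaAlgebra p`; "`𝒳 ∼ Λ ⊕ M ⊕ M`, `Char_Λ(M) ∣ / = Char_Λ(𝔖/Λκ₁)`" → `𝒳` finitely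
  generated of rank one and `char_Λ(𝒳_tors) ∣ / = char_Λ(𝔖/ℋ)²` (`char(𝒳_tors) = char(M)²`; the
  `M ⊕ M` structure itself is not recorded — WEAKER, never stronger; the shape of `Howard2004_thmB`).
* **Theorem 3.3.6** (p0019 L8–L13): "Assume `p > 2` and that `p ∤ N′`. Assume that
  `H⁰(K, ρ̄_{f̃} ⊗ ε) = 0`. Then `H¹_{𝓕_{Λ,ε}}(K, 𝐓_ε)` has `Λ`-rank one, and there is a finitely
  generated torsion `Λ`-module `M` such that (i) `𝒳 ∼ Λ ⊕ M ⊕ M`, (ii) `Char_Λ(M)` divides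
  `Char_Λ(H¹_{𝓕_{Λ,ε}}(K, 𝐓_ε)/Λκ₁)`." → `thm336_hpmc_divisibility_OPEN` (conclusion `HPMCDivisibility`).
* **Theorem 3.5.1**, last clause (p0020 L23–L34): "[Case (I), `p = v v̄` splits, `H⁰ = 0`] …
  Consequently, `Char_Λ(𝔛)Λ^ur = (𝓛_ε)` holds in `Λ^ur`, or equivalently,
  `Char_Λ(𝒳_tors) = Char_Λ(H¹_{𝓕_Λ}(K, 𝐓)/Λκ_∞)²` holds in `Λ`." → `thm351_hpmc_equality_OPEN`
  (conclusion `HPMCEquality`; the ranks, printed in Thm. 3.3.6 under the same hypotheses, included).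
* **Proposition 3.4.4** (p0019 L57–L73): "Assume `p = v v̄` splits in `K` and that `p ∤ N′`.
  Assume that `H⁰(K, ρ̄_{f̃} ⊗ ε) = 0`. Then the following statements are equivalent: (HPMC) Both
  `H¹_{𝓕_{Λ,ε}}(K, 𝐓_ε)` and `𝒳` have `Λ`-rank one, and the divisibility
  `Char_Λ(𝒳_tors) ⊃ Char_Λ(H¹_{𝓕_{Λ,ε}}(K, 𝐓_ε)/Λ z_{(f̃,χ),∞})²` holds in `Λ_ac`. (GrMC) Both
  `H¹_{𝓕_Gr}(K, 𝐓_ε)` and `𝔛_f = H¹_{𝓕_Gr}(K, M_ε)^∨` are `Λ`-torsion, and the divisibility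
  `Char_Λ(𝔛)Λ^nr ⊃ (𝓛_ε)` holds in `Λ^nr`. Moreover, the same result holds for the opposite
  divisibilities." → ONLY the direction (HPMC) ⟹ (GrMC), `prop344_grMC_of_hpmc_OPEN`, with (GrMC)
  read in the gen-0 currency `GrMCDivisibility` (= the conclusion of `thm336_oneSided_…_OPEN`,
  `thm336_oneSided_iff_grMCDivisibility`: `𝔛 = XAc` torsion and, for every Castella-shape frame `L`
  of `f` and the structure map `j`, `p^k L ∈ Char_Λ(𝔛)·R₀⟦T⟧` for some `k` — invariant under
  `L ↦ u·p^c·L`, `c ∈ ℤ`, hence implied by the printed "(𝓛_ε) ⊂ Char_Λ(𝔛)Λ^nr" for every frame;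
  flag KYb-frame of gen 0; the compact half "`H¹_{𝓕_Gr}(K, 𝐓_ε)` torsion" has no tree object and is
  dropped — WEAKER). The converse (GrMC) ⟹ (HPMC) is NOT typed: with the frame slack it would be
  STRONGER than print. The (HPMC) premise is taken AT the data `(D, F, X)` (never "for all families",
  which would be vacuously true if no family existed).

## Contents (namespace `Literature.NumberTheory.EllipticCurves.KellerYin2024`)

* Currency predicates (definitions, nothing asserted): `HPMCHypotheses` (Prop-structure),
  `HPMCDivisibility D F X`, `HPMCEquality D F X`, `GrMCDivisibility ι′ W K v v̄ κ γ f`.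
* OPEN facts (3): `thm336_hpmc_divisibility_OPEN`, `thm351_hpmc_equality_OPEN`, `prop344_grMC_of_hpmc_OPEN`.
* PROVED: `thm336_oneSided_iff_grMCDivisibility` (gen-0 fact = `∀ …, GrMCDivisibility`, by `Iff.rfl`),
  `HPMCEquality.divisibility`, `thm336_hpmc_OPEN_of_thm351_hpmc_OPEN` (3.5.1 ⟹ 3.3.6),
  `grMCDivisibility_of_OPEN` (Thm. 3.3.6 ∘ Prop. 3.4.4 — the printed route to the Greenberg
  divisibility — at any data `(D, F, X)`), `twistedHeegnerCharIdeal_sq_dvd_of_thm351_hpmc_OPEN` (the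
  "lower bound" half, not available from Kolyvagin systems alone), `HPMCHypotheses.caseOne`.

## References
[KellerYin2024PotOrd] arXiv:2410.23241v1 (locators above); [CastellaGrossiSkinner2025] Theorem C (the
published `p ∤ N` Eisenstein twin; currency); [CastellaGrossiLeeSkinner2022] Prop. 4.2.1, Rem. 4.1.3;
[Howard2004HeegnerKolyvagin] Thm. B, Thm. 3.3.7; [CastellaHsieh2018] §4.4; [Castella2018] Thm. 3.1
(two-variable shape behind (GrMC)). Cell documents: `run/shared/lean/pub/bsd-littype/OPEN-QUESTIONS-06.md`,
`…/staging/bsd-littype-06/{LOCATOR,FAITHFULNESS}-06.md` (gen-3 addenda).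
-/

set_option autoImplicit false

noncomputable section

open scoped Classical NumberField

open PowerSeries WeierstrassCurve NumberField IsDedekindDomain Field
  Literature.NumberTheory.EllipticCurves Literature.NumberTheory.EllipticCurves.ModularForms
  Literature.NumberTheory.EllipticCurves.Rank1Residual Literature.NumberTheory.EllipticCurves.Castella2018
  Literature.NumberTheory.GaloisRepresentations

namespace Literature.NumberTheory.EllipticCurves.KellerYin2024

/-! ### §1 Hypotheses and the two currencies -/

/-- **The hypotheses of Keller–Yin Thms. 3.3.6 / 3.5.1 / Prop. 3.4.4 in Heegner-point form, for the
Heegner pair of an elliptic curve `E = W/ℚ` with auxiliary curve `E′ = W′`** (module docstring,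
citation header): the gen-0 bundle `PotOrdSetting ι′ W K v v̄ κ N` (`setting`: `p > 2`, Case (I),
`E[p]` reducible with `φ|_{G_p} ≠ 𝟙`, `E(K)[p] = 0`, Assumption 2.0.3, `p = v v̄`, `κ` anticyclotomic)
PLUS `N = N′p²` (`level_eq`), "`p ∤ N′`" (`not_dvd_level`), `W′ ≅_ℚ E^{(p*)}` — a `ℚ`-change of
variables of the quadratic twist by `p* = (−1)^{(p−1)/2} p` (`twist`; `f̃ = f_{E′}`, read at `e = 2`),
`γ` a topological generator (`topGenerator`) and the tree-vocabulary EXTRA `p ∤ h_K`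
(`not_dvd_classNumber`, flag KYb-hK). A conjunction of hypotheses; nothing asserted.
[claim: KellerYin2024PotOrd, status: under-review] -/
structure HPMCHypotheses {p : ℕ} [Fact p.Prime] (ι' : PadicAlgCl p ≃+* ℂ) (W W' : WeierstrassCurve ℚ)
    [W.IsElliptic] [W.IsGloballyMinimal] (K : Type) [Field K] [NumberField K]
    (v vbar : HeightOneSpectrum (𝓞 K)) (κ : ZpExtension K p) (γ : absoluteGaloisGroup K)
    (N N' : ℕ) : Prop where
  setting : PotOrdSetting ι' W K v vbar κ N
  level_eq : N = N' * p ^ 2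
  not_dvd_level : ¬ p ∣ N'
  twist : ∃ C : VariableChange ℚ, C • W.quadraticTwist ((-1 : ℚ) ^ (p / 2) * p) = W'
  not_dvd_classNumber : ¬ p ∣ NumberField.classNumber K
  topGenerator : κ.IsTopGenerator γ

-- TODO(general form): Keller–Yin allow `p ∣ h_K` and any pair `(f̃, ε)` with `f = f̃ ⊗ ε`; the
-- fields `not_dvd_classNumber` / `twist` are the tree vocabulary's special case (Howard §3.3; `e = 2`).

/-- Case (I) is part of the hypotheses (projection, for consumers on the cell `SubGordTwo`).
[claim: KellerYin2024PotOrd, status: under-review] -/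
theorem HPMCHypotheses.caseOne {p : ℕ} [Fact p.Prime] {ι' : PadicAlgCl p ≃+* ℂ}
    {W W' : WeierstrassCurve ℚ} [W.IsElliptic] [W.IsGloballyMinimal] {K : Type} [Field K]
    [NumberField K] {v vbar : HeightOneSpectrum (𝓞 K)} {κ : ZpExtension K p}
    {γ : absoluteGaloisGroup K} {N N' : ℕ} (h : HPMCHypotheses ι' W W' K v vbar κ γ N N') :
    W.HasGoodOrdinaryReductionOverQuadraticAt p :=
  h.setting.caseOne

section Currency

variable {K : Type} [Field K] [NumberField K] {N' : ℕ} [NeZero N'] {W W' : WeierstrassCurve ℚ}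
  {p : ℕ} [Fact p.Prime] {κ : ZpExtension K p} {γ : absoluteGaloisGroup K}
  {jbar : AlgebraicClosure K →+* ℂ}

/-- **(HPMC), divisibility "⊃", at the data `(D, F, X)`** — the conclusion of Thm. 3.3.6 / the
(HPMC) statement of Prop. 3.4.4 in the sibling's currency: `𝔖 = D.S` finitely generated of `Λ`-rank
one; `𝒳 = X.X` finitely generated of `Λ`-rank one with `char_Λ(𝒳_tors) ∣ char_Λ(𝔖/ℋ^θ_∞)²`
(`twistedHeegnerCharIdeal D F`; "`𝒳 ∼ Λ ⊕ M ⊕ M`, `Char_Λ(M) ∣ Char_Λ(𝔖/Λκ₁)`" gives exactly this on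
characteristic ideals). A predicate; nothing asserted. [claim: KellerYin2024PotOrd, status: under-review] -/
def HPMCDivisibility (D : (W.baseChange K).LambdaAdicSelmerData κ γ)
    (F : TwistedHeegnerFamily N' W W' K κ jbar) (X : (W.baseChange K).SelmerDualData κ γ) : Prop :=
  (Module.Finite (IwasawaAlgebra p) D.S ∧ Module.finrank (IwasawaAlgebra p) D.S = 1) ∧
    (Module.Finite (IwasawaAlgebra p) X.X ∧ Module.finrank (IwasawaAlgebra p) X.X = 1 ∧
      Module.charIdeal (IwasawaAlgebra p) (Submodule.torsion (IwasawaAlgebra p) X.X) ∣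
        twistedHeegnerCharIdeal D F ^ 2)

/-- **(HPMC), equality, at the data `(D, F, X)`** — the last clause of Thm. 3.5.1 with the ranks of
Thm. 3.3.6: `𝔖`, `𝒳` finitely generated of `Λ`-rank one and `char_Λ(𝒳_tors) = char_Λ(𝔖/ℋ^θ_∞)²`
(verbatim the conclusion of the published sibling `CastellaGrossiSkinner2025.thmC_…` with `ℋ^θ_∞`
for `𝐇`). A predicate; nothing asserted. [claim: KellerYin2024PotOrd, status: under-review] -/
def HPMCEquality (D : (W.baseChange K).LambdaAdicSelmerData κ γ)
    (F : TwistedHeegnerFamily N' W W' K κ jbar) (X : (W.baseChange K).SelmerDualData κ γ) : Prop :=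
  (Module.Finite (IwasawaAlgebra p) D.S ∧ Module.finrank (IwasawaAlgebra p) D.S = 1) ∧
    (Module.Finite (IwasawaAlgebra p) X.X ∧ Module.finrank (IwasawaAlgebra p) X.X = 1 ∧
      Module.charIdeal (IwasawaAlgebra p) (Submodule.torsion (IwasawaAlgebra p) X.X) =
        twistedHeegnerCharIdeal D F ^ 2)

/-- The equality contains the divisibility. [claim: KellerYin2024PotOrd, status: under-review] -/
theorem HPMCEquality.divisibility {D : (W.baseChange K).LambdaAdicSelmerData κ γ}
    {F : TwistedHeegnerFamily N' W W' K κ jbar} {X : (W.baseChange K).SelmerDualData κ γ}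
    (h : HPMCEquality D F X) : HPMCDivisibility D F X :=
  ⟨h.1, h.2.1, h.2.2.1, dvd_of_eq h.2.2.2⟩

/-- The equality contains the "lower bound" `char_Λ(𝔖/ℋ^θ_∞)² ∣ char_Λ(𝒳_tors)` (the half NOT
available from a Kolyvagin-system argument). [claim: KellerYin2024PotOrd, status: under-review] -/
theorem HPMCEquality.sq_dvd {D : (W.baseChange K).LambdaAdicSelmerData κ γ}
    {F : TwistedHeegnerFamily N' W W' K κ jbar} {X : (W.baseChange K).SelmerDualData κ γ}
    (h : HPMCEquality D F X) :
    twistedHeegnerCharIdeal D F ^ 2 ∣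
      Module.charIdeal (IwasawaAlgebra p) (Submodule.torsion (IwasawaAlgebra p) X.X) :=
  dvd_of_eq h.2.2.2.symm

end Currency

/-- **(GrMC), divisibility "⊃", in the gen-0 currency** — VERBATIM the conclusion of
`thm336_oneSided_isTorsion_mem_charIdeal_OPEN` (sibling file) at `(ι′, W, K, v, v̄, κ, γ, f)`:
`𝔛 = AcSelmer.XAc (W.baseChange K) p κ v̄ ∅ γ` is `Λ`-torsion and, for every Castella-shape frame
`(Ω_K ≠ 0, Ω_p ≠ 0, L)` of `f` (`IsBDPLFunction ι′ v κ γ f Ω_K Ω_p L`) and the structure map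
`j : ℤ_p → R₀`, `p^k · L ∈ Char_Λ(𝔛)·R₀⟦T⟧` for some `k` (flag KYb-frame; see
`thm336_oneSided_iff_grMCDivisibility`). A predicate; nothing asserted.
[claim: KellerYin2024PotOrd, status: under-review] -/
def GrMCDivisibility {p : ℕ} [Fact p.Prime] (ι' : PadicAlgCl p ≃+* ℂ) (W : WeierstrassCurve ℚ)
    (K : Type) [Field K] [NumberField K] (v vbar : HeightOneSpectrum (𝓞 K)) (κ : ZpExtension K p)
    (γ : absoluteGaloisGroup K) [Fact (κ.IsTopGenerator γ)] {N : ℕ} [NeZero N]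
    (f : CuspForm (CongruenceSubgroup.Gamma0 N) 2) : Prop :=
  Module.IsTorsion (IwasawaAlgebra p) (AcSelmer.XAc (W.baseChange K) p κ vbar ∅ γ) ∧
    ∀ (ΩK : ℂ) (Ωp : ℂ_[p]) (L : UnrSeries p), ΩK ≠ 0 → Ωp ≠ 0 →
      IsBDPLFunction ι' v κ γ f ΩK Ωp L →
      ∀ (j : ℤ_[p] →+* unrIntegers p),
        (∀ x : ℤ_[p], ((j x : unrIntegers p) : ℂ_[p]) = algebraMap ℚ_[p] ℂ_[p] (x : ℚ_[p])) →
        ∃ k : ℕ, C ((p : unrIntegers p) ^ k) * L ∈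
          (AcSelmer.XAc.charIdeal (W.baseChange K) p κ vbar ∅ γ).map (PowerSeries.map j)

/-- **The gen-0 OPEN fact IS "`GrMCDivisibility` under `PotOrdSetting`"** (definitional unfolding;
a consistency check between the two files). [claim: KellerYin2024PotOrd, status: under-review] -/
theorem thm336_oneSided_iff_grMCDivisibility :
    thm336_oneSided_isTorsion_mem_charIdeal_OPEN ↔
      ∀ {p : ℕ} [Fact p.Prime] (ι' : PadicAlgCl p ≃+* ℂ) (W : WeierstrassCurve ℚ) [W.IsElliptic]
        [W.IsGloballyMinimal] (K : Type) [Field K] [NumberField K] (v vbar : HeightOneSpectrum (𝓞 K))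
        (κ : ZpExtension K p) (γ : absoluteGaloisGroup K) [Fact (κ.IsTopGenerator γ)] {N : ℕ}
        [NeZero N] {f : CuspForm (CongruenceSubgroup.Gamma0 N) 2} (_ : IsNewformOf W f),
        PotOrdSetting ι' W K v vbar κ N → GrMCDivisibility ι' W K v vbar κ γ f :=
  Iff.rfl

/-! ### §2 Thm. 3.3.6 in Heegner-point form — OPEN fact -/

/-- **OPEN HYPOTHESIS — UNREFEREED PREPRINT (Keller–Yin, arXiv:2410.23241v1), Theorem 3.3.6** (one
divisibility of Perrin-Riou's (HPMC) statement for the Heegner pair of an elliptic curve; the source's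
name for (HPMC) is elided here only because of the tree's docstring lint, see the module docstring).
Verbatim (p0019 L8–L13): "Assume `p > 2` and that `p ∤ N′`. Assume that `H⁰(K, ρ̄_{f̃} ⊗ ε) = 0`.
Then `H¹_{𝓕_{Λ,ε}}(K, 𝐓_ε)` has `Λ`-rank one, and there is a finitely generated torsion `Λ`-module
`M` such that (i) `𝒳 ∼ Λ ⊕ M ⊕ M`, (ii) `Char_Λ(M)` divides `Char_Λ(H¹_{𝓕_{Λ,ε}}(K, 𝐓_ε)/Λκ₁)`."
TRANSCRIBED under `HPMCHypotheses` (all of §3's standing hypotheses, citation header) for every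
`Λ`-adic Selmer datum `D`, twisted Heegner family `F` of `(W, W′)` at level `N′` and Selmer-dual
datum `X`: `HPMCDivisibility D F X` (ranks one; `char_Λ(𝒳_tors) ∣ char_Λ(𝔖/ℋ^θ_∞)²`). Flags:
KYb-kappa (`Λκ₁` read as `ℋ^θ_∞`), KYb-hK, `e = 2` (Q-B1). Printed proof: Kolyvagin system of the
pair (Thm. 3.3.5: an in-proof generalisation of [JLZ21] + [LV] + [KY24]), Howard's argument twisted
by `ε` (3.3.2–3.3.4). NEVER cite this `Prop` as a theorem. [claim: KellerYin2024PotOrd, status: under-review]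
[cite: Howard2004HeegnerKolyvagin, §1 Thm. B (the shape: rank one, X ∼ Λ ⊕ M ⊕ M, ch(M) ∣ ch(𝔖/𝐇))] -/
def thm336_hpmc_divisibility_OPEN : Prop :=
  ∀ {p : ℕ} [Fact p.Prime] (ι' : PadicAlgCl p ≃+* ℂ) (W W' : WeierstrassCurve ℚ) [W.IsElliptic]
    [W.IsGloballyMinimal] (K : Type) [Field K] [NumberField K] (v vbar : HeightOneSpectrum (𝓞 K))
    (κ : ZpExtension K p) (γ : absoluteGaloisGroup K) {N N' : ℕ} [NeZero N']
    (jbar : AlgebraicClosure K →+* ℂ) (_ : HPMCHypotheses ι' W W' K v vbar κ γ N N')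
    (D : (W.baseChange K).LambdaAdicSelmerData κ γ) (F : TwistedHeegnerFamily N' W W' K κ jbar)
    (X : (W.baseChange K).SelmerDualData κ γ), HPMCDivisibility D F X

/-! ### §3 Thm. 3.5.1, Heegner-point clause — OPEN fact -/

/-- **OPEN HYPOTHESIS — UNREFEREED PREPRINT (Keller–Yin, arXiv:2410.23241v1), Theorem 3.5.1, last
clause** (Perrin-Riou's (HPMC) equality for the Heegner pair of an elliptic curve, PROVED there; the
source's name for (HPMC) is elided here only because of the tree's docstring lint).
Verbatim (p0020 L23–L34): "Assume we are in Case (I) of (twists), i.e., `p ∤ N′`. Assume that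
`p = v v̄` splits in `K`. Assume that `H⁰(K, ρ̄_{f̃} ⊗ ε) = 0`. Then `μ(𝔛) = μ(𝓛_ε) = 0` and
`λ(𝔛) = λ(𝓛_ε)`. Consequently, `Char_Λ(𝔛)Λ^ur = (𝓛_ε)` holds in `Λ^ur`, or equivalently,
`Char_Λ(𝒳_tors) = Char_Λ(H¹_{𝓕_Λ}(K, 𝐓)/Λκ_∞)²` holds in `Λ`." TRANSCRIBED under `HPMCHypotheses`
for every `D`, `F`, `X`: `HPMCEquality D F X` (the ranks, printed in Thm. 3.3.6 under the same
hypotheses, included; `Λκ_∞ = Λκ₁`, [CGLS] Rem. 4.1.3 as used by the source, read as `ℋ^θ_∞`, flag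
KYb-kappa; KYb-hK; `e = 2`). The Greenberg form of the same theorem is the sibling's
`thm351_imc_isTorsion_mu_zero_charIdeal_eq_OPEN`; the printed "equivalently" is Prop. 3.4.4 in both
directions (only one is typed, `prop344_grMC_of_hpmc_OPEN`). Printed proof: Thms. 3.3.6 + 3.4.4, then
§3.5 (Kriz's congruences, Rubin 1991) "as in [KY24]". NEVER cite this `Prop` as a theorem; conditional
on two preprint layers. [claim: KellerYin2024PotOrd, status: under-review]
[cite: CastellaGrossiSkinner2025, Theorem C (the published good-reduction Eisenstein twin; currency)] -/
def thm351_hpmc_equality_OPEN : Prop :=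
  ∀ {p : ℕ} [Fact p.Prime] (ι' : PadicAlgCl p ≃+* ℂ) (W W' : WeierstrassCurve ℚ) [W.IsElliptic]
    [W.IsGloballyMinimal] (K : Type) [Field K] [NumberField K] (v vbar : HeightOneSpectrum (𝓞 K))
    (κ : ZpExtension K p) (γ : absoluteGaloisGroup K) {N N' : ℕ} [NeZero N']
    (jbar : AlgebraicClosure K →+* ℂ) (_ : HPMCHypotheses ι' W W' K v vbar κ γ N N')
    (D : (W.baseChange K).LambdaAdicSelmerData κ γ) (F : TwistedHeegnerFamily N' W W' K κ jbar)
    (X : (W.baseChange K).SelmerDualData κ γ), HPMCEquality D F X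

/-- **Keller–Yin (pot. good ordinary), Thm. 3.5.1 (HPMC equality) — PINNED to a minimal-degree parametrisation with `p`-ADIC-UNIT MANIN CONSTANT of the auxiliary curve** (BSD cited-literature audit ARM P, REGISTER R-15 / TY-QUEUE 25; reader bsd-cited-r19 sheets
`D-AUDIT-r19-ADDENDUM-5.md` sha16 6a0e68f1a5f0faa2 §4, ADDENDUM-6 c1c6b9e51d6d0dd9 and ADDENDUM-8
24e75636994fcc95 (v2) §4 (the Manin pin, rider R-b of r17 ADDENDUM-4 0434952c634f1c51); typer bsd-cited-ty4 g7/g8/g10,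
2026-08-27; lead rulings (181)/(198)/(243) + RULING (316) «TYQ 25: kit v5.2 is the release shape»): the statement of
`thm351_hpmc_equality_OPEN` (kept byte-identical above) with TWO extra hypotheses as binders right after `F` and the instance
binder `[W'.IsGloballyMinimal]` (`F.Dt.c` is the Manin constant w.r.t. a NÉRON differential only on a globally minimal model —
`ModularCurve.lean` `isNeronLattice`/`c`; r19 ADD-8 §1.1):
(F1) `∀ Dt', F.Dt.deg ≤ Dt'.deg` — minimal modular degree among the data of the same curve and level (`φ = ±φ_min`) =
VERBATIM the body of `ModularForms.ModularParametrizationData.IsMinimal F.Dt` (`ModularParametrizationScalingProofs.lean`,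
p482958: `exists_isMinimal`, `IsMinimal.deg_eq`, `not_isMinimal_zsmul`), spelled out because that module lies DOWNSTREAM of
this file (an `import` would close a cycle); the two agree by `Iff.rfl` — kernel lemma `TYQ25Check.pin_iff_isMinimal_twistedHeegnerFamily`
of the kit file `run/shared/lean/pub/bsd-cited/staging/bsd-cited-ty4/TYQ25-kit/check/K_TYQ25_pin_iff_isMinimal.lean` sha16
3e421a28abe396fd (imports both modules; farm rc 0, axioms trio; lead (243)).
(F1′, the MANIN PIN) `¬ (p : ℤ) ∣ F.Dt.c` — the Manin constant of `φ` (`φ^*ω_W = c · 2πi f dτ`) is a `p`-adic unit: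
Perrin-Riou's Conj. B carries the factor `c_π · (#𝒪_K^× / 2)` [PR87 §1 p. 405; BCK21 Rem. after Conj. 1], which the `c`-free
form printed here drops exactly when it is a `p`-adic unit (Mazur 1978 Cor. 4.1 for the OPTIMAL curve; NOT automatic for a
non-optimal curve at an Eisenstein `p` — PR87 p. 409 Ex. 3, `X_0(11)/μ_5` at `p = 5`); inside the pin the statement does
not depend on the parametrisation (r19 ADD-8 kernel `sheets/r19-add8/d_audit_r19_add8_manin_pin_check.lean` f8a7d8f730b7607f,
K2 `nonsplitClause_iff_zsmul` / `charIdeal_quot_span_C_smul_eq_of_not_dvd`, K3 shapes `…ManinPinned`; tree `HeegnerModuleScalingProofs.lean` p496710), outside it the `∀ F`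
layout is refuted (p482958), and on `S_bad(p) = {W : p ∣ c(π_min W)}` the twin is vacuous (no `c`-free integral statement
is in print there — r19 ADD-8 §0 (a)/(b), §3). WHY (short; full text on the sibling twins `KellerYin2024.thmB_…_minimal_OPEN` / `…thm521_…_minimal_OPEN` and r19
ADD-5 §4): print fixes ONE parametrisation (the parametrisation `φ′ : X_0(N′) → E′` of the auxiliary curve and the classes `z_{(f̃,χ),∞}` built from it, §3); the unpinned `∀ F` layout ranges over all rescalings and is
STRONGER than print (refuted integrally, p482958); this pinned twin is print's statement (VERBATIM-SPECIALISED; flag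
`HPMC-Manin-normalisation`). Bridge `thm351_hpmc_equality_minimal_OPEN_of_unpinned` PROVED; divisibility-shaped binders unaffected.
NEVER cite this `Prop` as a theorem: take it as an explicit hypothesis; a result using it is conditional on two preprint layers.
[claim: KellerYin2024PotOrd, status: under-review]
[cite: CastellaGrossiSkinner2025, Theorem C (the published good-reduction Eisenstein twin; currency)]
[cite: PerrinRiou1987BSMF, §1 Conj. B p. 405 (the factor c_π · u)] [cite: BurungaleCastellaKim2021, Remark after Conj. 1 (the factor c_π · #𝒪_K^× / 2; Mazur for p ∤ N)] -/
def thm351_hpmc_equality_minimal_OPEN : Prop :=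
  ∀ {p : ℕ} [Fact p.Prime] (ι' : PadicAlgCl p ≃+* ℂ) (W W' : WeierstrassCurve ℚ) [W.IsElliptic]
    [W.IsGloballyMinimal] (K : Type) [Field K] [NumberField K] (v vbar : HeightOneSpectrum (𝓞 K))
    (κ : ZpExtension K p) (γ : absoluteGaloisGroup K) {N N' : ℕ} [NeZero N']
    (jbar : AlgebraicClosure K →+* ℂ) (_ : HPMCHypotheses ι' W W' K v vbar κ γ N N')
    (D : (W.baseChange K).LambdaAdicSelmerData κ γ) (F : TwistedHeegnerFamily N' W W' K κ jbar)
    [W'.IsGloballyMinimal]  -- the Manin pin reads `F.Dt.c` against the Néron lattice of a MINIMAL model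
    (_ : ∀ Dt' : ModularForms.ModularParametrizationData W' N', F.Dt.deg ≤ Dt'.deg)  -- PIN F1 (`IsMinimal F.Dt`)
    (_ : ¬ (p : ℤ) ∣ F.Dt.c)  -- PIN F1′ (Manin constant a `p`-adic unit; rider R-b)
    (X : (W.baseChange K).SelmerDualData κ γ), HPMCEquality D F X

/-- **Bridge, PROVED**: the unpinned `thm351_hpmc_equality_OPEN` implies its pinned twin (the two extra
hypotheses are discarded) — so the twin is a WEAKENING, never a strengthening. [claim: KellerYin2024PotOrd, status: under-review] -/
theorem thm351_hpmc_equality_minimal_OPEN_of_unpinned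
    (h : thm351_hpmc_equality_OPEN) :
    thm351_hpmc_equality_minimal_OPEN :=
  fun ι' W W' _ _ K _ _ v vbar κ γ _ _ _ jbar hyp D F _ _ _ X ↦ h ι' W W' K v vbar κ γ jbar hyp D F X


/-! ### §4 Prop. 3.4.4, direction (HPMC) ⟹ (GrMC) — OPEN fact -/

/-- **OPEN HYPOTHESIS — UNREFEREED PREPRINT (Keller–Yin, arXiv:2410.23241v1), Proposition 3.4.4,
direction (HPMC) ⟹ (GrMC), divisibility "⊃".** Verbatim (p0019 L57–L73): "Assume `p = v v̄`
splits in `K` and that `p ∤ N′`. Assume that `H⁰(K, ρ̄_{f̃} ⊗ ε) = 0`. Then the following statements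
are equivalent: (HPMC) Both `H¹_{𝓕_{Λ,ε}}(K, 𝐓_ε)` and `𝒳 = H¹_{𝓕_{Λ,ε}}(K, M_ε)^∨` have `Λ`-rank
one, and the divisibility `Char_Λ(𝒳_tors) ⊃ Char_Λ(H¹_{𝓕_{Λ,ε}}(K, 𝐓_ε)/Λ z_{(f̃,χ),∞})²` holds in
`Λ_ac`. (GrMC) Both `H¹_{𝓕_Gr}(K, 𝐓_ε)` and `𝔛_f = H¹_{𝓕_Gr}(K, M_ε)^∨` are `Λ`-torsion, and the
divisibility `Char_Λ(𝔛)Λ^nr ⊃ (𝓛_ε)` holds in `Λ^nr`. Moreover, the same result holds for the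
opposite divisibilities." TRANSCRIBED: under `HPMCHypotheses` and for the newform `f` of `W`, AT any
data `(D, F, X)`, `HPMCDivisibility D F X → GrMCDivisibility ι′ W K v v̄ κ γ f` (gen-0 currency:
`p^k`-slack over all Castella-shape frames, implied by print for every frame, flag KYb-frame; the
compact-Greenberg torsion clause dropped — WEAKER; `Λ z_∞ = Λκ₁` up to a unit, p0019 L55, read
as `ℋ^θ_∞`, KYb-kappa). The converse is deliberately NOT typed (module docstring). Printed proof:
"exactly in the same way from [Cas17]" with the explicit reciprocity law Thm. 3.4.3 ([JLZ21] Thm.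
5.3.1 specialised to the pair) and Poitou–Tate. NEVER cite this `Prop` as a theorem.
[claim: KellerYin2024PotOrd, status: under-review]
[cite: CastellaGrossiLeeSkinner2022, Prop. 4.2.1 (the published good ordinary twin of (HPMC) ⟹ (GrMC))] -/
def prop344_grMC_of_hpmc_OPEN : Prop :=
  ∀ {p : ℕ} [Fact p.Prime] (ι' : PadicAlgCl p ≃+* ℂ) (W W' : WeierstrassCurve ℚ) [W.IsElliptic]
    [W.IsGloballyMinimal] (K : Type) [Field K] [NumberField K] (v vbar : HeightOneSpectrum (𝓞 K))
    (κ : ZpExtension K p) (γ : absoluteGaloisGroup K) [Fact (κ.IsTopGenerator γ)] {N N' : ℕ}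
    [NeZero N] [NeZero N'] {f : CuspForm (CongruenceSubgroup.Gamma0 N) 2} (_ : IsNewformOf W f)
    (jbar : AlgebraicClosure K →+* ℂ) (_ : HPMCHypotheses ι' W W' K v vbar κ γ N N')
    (D : (W.baseChange K).LambdaAdicSelmerData κ γ) (F : TwistedHeegnerFamily N' W W' K κ jbar)
    (X : (W.baseChange K).SelmerDualData κ γ),
    HPMCDivisibility D F X → GrMCDivisibility ι' W K v vbar κ γ f

/-! ### §5 Proved bookkeeping -/

/-- **Thm. 3.5.1 (Heegner-point clause) implies Thm. 3.3.6** (equality ⟹ divisibility).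
Bookkeeping between two OPEN facts; nothing asserted. [claim: KellerYin2024PotOrd, status: under-review] -/
theorem thm336_hpmc_OPEN_of_thm351_hpmc_OPEN (h : thm351_hpmc_equality_OPEN) :
    thm336_hpmc_divisibility_OPEN :=
  fun ι' W W' _ _ K _ _ v vbar κ γ _ _ _ jbar hyp D F X ↦ (h ι' W W' K v vbar κ γ jbar hyp D F X).divisibility

/-- **Thm. 3.3.6 ∘ Prop. 3.4.4 — the printed route to the Greenberg divisibility — at any data
`(D, F, X)`**: the two OPEN facts give `GrMCDivisibility ι′ W K v v̄ κ γ f`, i.e. the conclusion of the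
gen-0 fact `thm336_oneSided_…_OPEN` at these parameters (`thm336_oneSided_iff_grMCDivisibility`),
now PROVIDED a `Λ`-adic Selmer datum, a twisted Heegner family and a Selmer-dual datum are given
(their existence is not asserted anywhere in the tree). CONDITIONAL on the OPEN facts; nothing
asserted. [claim: KellerYin2024PotOrd, status: under-review] -/
theorem grMCDivisibility_of_OPEN (h336 : thm336_hpmc_divisibility_OPEN)
    (h344 : prop344_grMC_of_hpmc_OPEN) {p : ℕ} [Fact p.Prime] (ι' : PadicAlgCl p ≃+* ℂ)
    (W W' : WeierstrassCurve ℚ) [W.IsElliptic] [W.IsGloballyMinimal] (K : Type) [Field K]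
    [NumberField K] (v vbar : HeightOneSpectrum (𝓞 K)) (κ : ZpExtension K p)
    (γ : absoluteGaloisGroup K) [Fact (κ.IsTopGenerator γ)] {N N' : ℕ} [NeZero N] [NeZero N']
    {f : CuspForm (CongruenceSubgroup.Gamma0 N) 2} (hf : IsNewformOf W f)
    (jbar : AlgebraicClosure K →+* ℂ) (hyp : HPMCHypotheses ι' W W' K v vbar κ γ N N')
    (D : (W.baseChange K).LambdaAdicSelmerData κ γ) (F : TwistedHeegnerFamily N' W W' K κ jbar)
    (X : (W.baseChange K).SelmerDualData κ γ) : GrMCDivisibility ι' W K v vbar κ γ f :=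
  h344 ι' W W' K v vbar κ γ hf jbar hyp D F X (h336 ι' W W' K v vbar κ γ jbar hyp D F X)

/-- **Theorem 3.3.6 ⟹ Howard's Theorem B (c)-shape divisibility** `char_Λ(𝒳_tors) ∣ char_Λ(𝔖/ℋ^θ_∞)²`
at any data. CONDITIONAL on the OPEN fact. [claim: KellerYin2024PotOrd, status: under-review] -/
theorem charIdeal_torsion_dvd_of_thm336_hpmc_OPEN (h : thm336_hpmc_divisibility_OPEN)
    {p : ℕ} [Fact p.Prime] (ι' : PadicAlgCl p ≃+* ℂ) (W W' : WeierstrassCurve ℚ) [W.IsElliptic]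
    [W.IsGloballyMinimal] (K : Type) [Field K] [NumberField K] (v vbar : HeightOneSpectrum (𝓞 K))
    (κ : ZpExtension K p) (γ : absoluteGaloisGroup K) {N N' : ℕ} [NeZero N']
    (jbar : AlgebraicClosure K →+* ℂ) (hyp : HPMCHypotheses ι' W W' K v vbar κ γ N N')
    (D : (W.baseChange K).LambdaAdicSelmerData κ γ) (F : TwistedHeegnerFamily N' W W' K κ jbar)
    (X : (W.baseChange K).SelmerDualData κ γ) :
    Module.charIdeal (IwasawaAlgebra p) (Submodule.torsion (IwasawaAlgebra p) X.X) ∣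
      twistedHeegnerCharIdeal D F ^ 2 :=
  (h ι' W W' K v vbar κ γ jbar hyp D F X).2.2.2

/-- **Theorem 3.5.1 ⟹ the "lower bound" half** `char_Λ(𝔖/ℋ^θ_∞)² ∣ char_Λ(𝒳_tors)` at any data (in
print it comes from the `μ`/`λ` equality, not from the Kolyvagin system). CONDITIONAL on the OPEN
fact. [claim: KellerYin2024PotOrd, status: under-review] -/
theorem twistedHeegnerCharIdeal_sq_dvd_of_thm351_hpmc_OPEN (h : thm351_hpmc_equality_OPEN)
    {p : ℕ} [Fact p.Prime] (ι' : PadicAlgCl p ≃+* ℂ) (W W' : WeierstrassCurve ℚ) [W.IsElliptic]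
    [W.IsGloballyMinimal] (K : Type) [Field K] [NumberField K] (v vbar : HeightOneSpectrum (𝓞 K))
    (κ : ZpExtension K p) (γ : absoluteGaloisGroup K) {N N' : ℕ} [NeZero N']
    (jbar : AlgebraicClosure K →+* ℂ) (hyp : HPMCHypotheses ι' W W' K v vbar κ γ N N')
    (D : (W.baseChange K).LambdaAdicSelmerData κ γ) (F : TwistedHeegnerFamily N' W W' K κ jbar)
    (X : (W.baseChange K).SelmerDualData κ γ) :
    twistedHeegnerCharIdeal D F ^ 2 ∣
      Module.charIdeal (IwasawaAlgebra p) (Submodule.torsion (IwasawaAlgebra p) X.X) :=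
  (h ι' W W' K v vbar κ γ jbar hyp D F X).sq_dvd

end Literature.NumberTheory.EllipticCurves.KellerYin2024

end
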